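import Mathlib
import Summits.BirchSwinnertonDyer.BirchSwinnertonDyer.Theorems.Rank2ObservatoryThreeIsoDescentEhat
import Summits.BirchSwinnertonDyer.BirchSwinnertonDyer.Theorems.Rank2ObservatoryThreeIsoKField

/-!
# BirchSwinnertonDyer — rank ≥ 2 observatory, KERNEL-3ISO (G1): a norm-free primality kit for `ℤ[ζ₃]`

HONEST FRAMING: per-curve certified theorems and census instruments; no claim on BSD in rank ≥ 2.

Per-row inputs of `exists_normCut_class` (file `Rank2ObservatoryThreeIsoClassBound`) are a finite
family `P` of PRIMES of `𝓞 K`, `K = ℚ(ζ₃)`, with pairwise non-association and conjugation data. This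
file provides the elementary tools to certify them by `norm_num`/`decide`, through integer coordinates
`x = a + bη` (`η = hζ.toInteger`) and the norm form `a² - ab + b²` — no `Algebra.norm` needed:

* `toInteger_sq`, `exists_int_coords`, `int_coords_eq_zero`, `int_coords_unique` (`𝓞 K = ℤ ⊕ ℤη`);
* `coords_mul`, `mul_conj_coords`, `norm_form_mul`, `norm_form_nonneg` (multiplicativity of the form);
* `isUnit_of_norm_form_eq_one`, `norm_form_eq_one_of_isUnit`, `norm_form_dvd_of_dvd`,
  `norm_form_eq_of_associated` (units and association are read off the form);
* `prime_of_norm_form_prime` — SPLIT primes: `a² - ab + b²` prime ⇒ `a + bη` prime;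
* `prime_intCast_of_anisotropic` — INERT primes: `p` prime with `a² - ab + b²` anisotropic over `𝔽_p`
  (a `decide` for small `p`) ⇒ `(p : 𝓞 K)` prime; in particular `p = 2`;
* `prime_two_mul_toInteger_add_one` — the RAMIFIED prime `θ₀ = 2η + 1 = -η(η - 1) ~ λ`;
* `conj_coords` — `σ(a + bη) = (a - b) - bη` for `σ ζ = ζ²`.

No definitions. References: H. Cohen, *Number Theory I* (GTM 239, 2007), Prop. 8.4.8 (3);
H. Cohen, F. Pazuki, arXiv:0903.4963, §2 (the arithmetic of `ℤ[ζ₃]` used there); folklore.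
-/

set_option linter.dupNamespace false

noncomputable section

open NumberField Polynomial

namespace Summit.BirchSwinnertonDyer.BirchSwinnertonDyer.Rank2Observatory.ThreeIso

variable {K : Type*} [Field K] [NumberField K] [IsCyclotomicExtension {3} ℚ K] {ζ : K}
  (hζ : IsPrimitiveRoot ζ 3)

omit [NumberField K] [IsCyclotomicExtension {3} ℚ K] in
/-- `η² = -η - 1` in `𝓞 K`. [folklore] -/
theorem toInteger_sq : hζ.toInteger ^ 2 = -hζ.toInteger - 1 := by
  apply RingOfIntegers.coe_injective
  have h := zeta_sq_add_zeta_add_one hζ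
  change algebraMap (𝓞 K) K (hζ.toInteger ^ 2) = algebraMap (𝓞 K) K (-hζ.toInteger - 1)
  rw [map_pow, map_sub, map_neg, map_one]
  change ζ ^ 2 = -ζ - 1
  linear_combination h

/-- **Integer coordinates**: every algebraic integer of `ℚ(ζ₃)` is `a + bη`, `a b : ℤ`
(Mathlib's integral power basis of `η`, of dimension `φ(3) = 2`). [folklore] -/
theorem exists_int_coords (x : 𝓞 K) : ∃ a b : ℤ, x = a + b * hζ.toInteger := by
  obtain ⟨f, hf, hx⟩ := hζ.integralPowerBasis.exists_eq_aeval x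
  rw [IsPrimitiveRoot.integralPowerBasis_dim, show Nat.totient 3 = 2 by decide] at hf
  rw [IsPrimitiveRoot.integralPowerBasis_gen] at hx
  refine ⟨f.coeff 0, f.coeff 1, ?_⟩
  have hf1 : f = C (f.coeff 1) * X + C (f.coeff 0) :=
    eq_X_add_C_of_natDegree_le_one (by omega)
  rw [hx]
  conv_lhs => rw [hf1]
  rw [map_add, map_mul, aeval_C, aeval_X, aeval_C]
  simp only [eq_intCast]
  ring

omit [IsCyclotomicExtension {3} ℚ K] in
/-- Vanishing of integer coordinates. [folklore] -/
theorem int_coords_eq_zero {a b : ℤ} (h : (a : 𝓞 K) + b * hζ.toInteger = 0) : a = 0 ∧ b = 0 := by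
  have hθ := theta_sq_eq hζ
  have hK : (((a : ℚ) - b / 2 : ℚ) : K) + (((b : ℚ) / 2 : ℚ) : K) * (2 * ζ + 1) = 0 := by
    have h1 := congrArg (algebraMap (𝓞 K) K) h
    rw [map_add, map_mul, map_intCast, map_intCast, map_zero] at h1
    change (a : K) + b * ζ = 0 at h1
    push_cast
    linear_combination h1
  obtain ⟨h1, h2⟩ := rat_coords_eq_zero hθ hK
  have hb : (b : ℚ) = 0 := by linarith
  have ha : (a : ℚ) = 0 := by rw [hb] at h1; simpa using h1
  exact ⟨by exact_mod_cast ha, by exact_mod_cast hb⟩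

omit [IsCyclotomicExtension {3} ℚ K] in
/-- Uniqueness of integer coordinates. [folklore] -/
theorem int_coords_unique {a b c d : ℤ}
    (h : (a : 𝓞 K) + b * hζ.toInteger = (c : 𝓞 K) + d * hζ.toInteger) : a = c ∧ b = d := by
  have h0 : ((a - c : ℤ) : 𝓞 K) + ((b - d : ℤ) : 𝓞 K) * hζ.toInteger = 0 := by
    push_cast; linear_combination h
  obtain ⟨h1, h2⟩ := int_coords_eq_zero hζ h0
  omega

omit [NumberField K] [IsCyclotomicExtension {3} ℚ K] in
/-- Product in coordinates: `(a + bη)(c + dη) = (ac - bd) + (ad + bc - bd)η`. [folklore] -/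
theorem coords_mul (a b c d : ℤ) :
    ((a : 𝓞 K) + b * hζ.toInteger) * ((c : 𝓞 K) + d * hζ.toInteger) =
      ((a * c - b * d : ℤ) : 𝓞 K) + ((a * d + b * c - b * d : ℤ) : 𝓞 K) * hζ.toInteger := by
  push_cast
  linear_combination ((b : 𝓞 K) * d) * toInteger_sq hζ

omit [NumberField K] [IsCyclotomicExtension {3} ℚ K] in
/-- `(a + bη)·((a - b) - bη) = a² - ab + b²` (the element times its conjugate is the norm form).
[folklore] -/
theorem mul_conj_coords (a b : ℤ) :
    ((a : 𝓞 K) + b * hζ.toInteger) * (((a - b : ℤ) : 𝓞 K) - b * hζ.toInteger) =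
      ((a ^ 2 - a * b + b ^ 2 : ℤ) : 𝓞 K) := by
  push_cast
  linear_combination (-(b : 𝓞 K) * b) * toInteger_sq hζ

omit [NumberField K] [IsCyclotomicExtension {3} ℚ K] in
/-- Multiplicativity of the norm form (a polynomial identity). [folklore] -/
theorem norm_form_mul {R : Type*} [CommRing R] (a b c d : R) :
    (a * c - b * d) ^ 2 - (a * c - b * d) * (a * d + b * c - b * d) + (a * d + b * c - b * d) ^ 2 =
      (a ^ 2 - a * b + b ^ 2) * (c ^ 2 - c * d + d ^ 2) := by
  ring

omit [NumberField K] [IsCyclotomicExtension {3} ℚ K] in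
/-- The norm form is non-negative: `4(a² - ab + b²) = (2a - b)² + 3b²`. [folklore] -/
theorem norm_form_nonneg (a b : ℤ) : 0 ≤ a ^ 2 - a * b + b ^ 2 := by
  nlinarith [sq_nonneg (2 * a - b), sq_nonneg b]

omit [NumberField K] [IsCyclotomicExtension {3} ℚ K] in
/-- Norm form `1` ⇒ unit. [folklore] -/
theorem isUnit_of_norm_form_eq_one {a b : ℤ} (h : a ^ 2 - a * b + b ^ 2 = 1) :
    IsUnit ((a : 𝓞 K) + b * hζ.toInteger) :=
  IsUnit.of_mul_eq_one _ (by rw [mul_conj_coords hζ, h]; push_cast; rfl)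

/-- Unit ⇒ norm form `1`. [folklore] -/
theorem norm_form_eq_one_of_isUnit {a b : ℤ} (h : IsUnit ((a : 𝓞 K) + b * hζ.toInteger)) :
    a ^ 2 - a * b + b ^ 2 = 1 := by
  obtain ⟨y, hy⟩ := h.exists_right_inv
  obtain ⟨c, d, rfl⟩ := exists_int_coords hζ y
  rw [coords_mul hζ] at hy
  have h1 : ((a * c - b * d : ℤ) : 𝓞 K) + ((a * d + b * c - b * d : ℤ) : 𝓞 K) * hζ.toInteger =
      ((1 : ℤ) : 𝓞 K) + ((0 : ℤ) : 𝓞 K) * hζ.toInteger := by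
    rw [hy]; push_cast; ring
  obtain ⟨h2, h3⟩ := int_coords_unique hζ h1
  have h4 := norm_form_mul a b c d
  rw [h2, h3] at h4
  norm_num at h4
  exact Int.eq_one_of_mul_eq_one_right (norm_form_nonneg a b) h4.symm

/-- Divisibility ⇒ divisibility of norm forms. [folklore] -/
theorem norm_form_dvd_of_dvd {a b c d : ℤ}
    (h : (a : 𝓞 K) + b * hζ.toInteger ∣ (c : 𝓞 K) + d * hζ.toInteger) :
    a ^ 2 - a * b + b ^ 2 ∣ c ^ 2 - c * d + d ^ 2 := by
  obtain ⟨z, hz⟩ := h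
  obtain ⟨e, f, rfl⟩ := exists_int_coords hζ z
  rw [coords_mul hζ] at hz
  obtain ⟨h1, h2⟩ := int_coords_unique hζ hz
  exact ⟨e ^ 2 - e * f + f ^ 2, by rw [h1, h2]; exact norm_form_mul a b e f⟩

/-- Associated elements have the same norm form — so elements with DIFFERENT norm forms are not
associated (input `hna` of `exists_normCut_class`). [folklore] -/
theorem norm_form_eq_of_associated {a b c d : ℤ}
    (h : Associated ((a : 𝓞 K) + b * hζ.toInteger) ((c : 𝓞 K) + d * hζ.toInteger)) :
    a ^ 2 - a * b + b ^ 2 = c ^ 2 - c * d + d ^ 2 :=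
  Int.dvd_antisymm (norm_form_nonneg _ _) (norm_form_nonneg _ _) (norm_form_dvd_of_dvd hζ h.dvd)
    (norm_form_dvd_of_dvd hζ h.symm.dvd)

/-- **Split primes**: if `a² - ab + b²` is a (rational) prime then `a + bη` is prime in `𝓞 K`
(irreducible via the norm form; `𝓞 K` is a PID). [folklore; cf. CohenPazuki2009, §2] -/
theorem prime_of_norm_form_prime {a b : ℤ} (hp : Prime (a ^ 2 - a * b + b ^ 2)) :
    Prime ((a : 𝓞 K) + b * hζ.toInteger) := by
  haveI : IsPrincipalIdealRing (𝓞 K) := IsCyclotomicExtension.Rat.three_pid K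
  refine UniqueFactorizationMonoid.irreducible_iff_prime.mp (irreducible_iff.mpr ⟨fun hu => ?_, ?_⟩)
  · exact hp.not_unit (by rw [norm_form_eq_one_of_isUnit hζ hu]; exact isUnit_one)
  · intro x y hxy
    obtain ⟨c, d, rfl⟩ := exists_int_coords hζ x
    obtain ⟨c', d', rfl⟩ := exists_int_coords hζ y
    rw [coords_mul hζ] at hxy
    obtain ⟨ha, hb⟩ := int_coords_unique hζ hxy
    have hmul : a ^ 2 - a * b + b ^ 2 = (c ^ 2 - c * d + d ^ 2) * (c' ^ 2 - c' * d' + d' ^ 2) := by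
      rw [ha, hb]; exact norm_form_mul c d c' d'
    have key : ∀ {u v : ℤ}, IsUnit (u ^ 2 - u * v + v ^ 2) → IsUnit ((u : 𝓞 K) + v * hζ.toInteger) := by
      intro u v huv
      refine isUnit_of_norm_form_eq_one hζ ?_
      rcases Int.isUnit_iff.mp huv with h1 | h1
      · exact h1
      · have := norm_form_nonneg u v; omega
    rcases hp.irreducible.isUnit_or_isUnit hmul with hu | hu
    · exact Or.inl (key hu)
    · exact Or.inr (key hu)

/-- **Inert primes**: if `p` is prime and the norm form is anisotropic over `𝔽_p` (`p ≡ 2 (mod 3)`;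
for small `p` a `decide`), then `(p : 𝓞 K)` is prime. [folklore; cf. CohenPazuki2009, §2] -/
theorem prime_intCast_of_anisotropic (hζ : IsPrimitiveRoot ζ 3) {p : ℕ} (hp : p.Prime)
    (h : ∀ a b : ZMod p, a ^ 2 - a * b + b ^ 2 = 0 → a = 0 ∧ b = 0) :
    Prime ((p : ℤ) : 𝓞 K) := by
  haveI := Fact.mk hp
  refine ⟨by exact_mod_cast hp.ne_zero, fun hu => ?_, fun x y hxy => ?_⟩
  · have hu' : IsUnit (((p : ℤ) : 𝓞 K) + ((0 : ℤ) : 𝓞 K) * hζ.toInteger) := by simpa using hu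
    have h1 := norm_form_eq_one_of_isUnit hζ hu'
    have h2 : ((p : ℤ)) ^ 2 = 1 := by simpa using h1
    have h3 : (p : ℤ) = 1 := by
      nlinarith [hp.one_lt, sq_nonneg ((p : ℤ) - 1)]
    exact hp.one_lt.ne' (by exact_mod_cast h3)
  · obtain ⟨a, b, rfl⟩ := exists_int_coords hζ x
    obtain ⟨c, d, rfl⟩ := exists_int_coords hζ y
    obtain ⟨z, hz⟩ := hxy
    obtain ⟨e, f, rfl⟩ := exists_int_coords hζ z
    rw [coords_mul hζ] at hz
    have h1 : ((a * c - b * d : ℤ) : 𝓞 K) + ((a * d + b * c - b * d : ℤ) : 𝓞 K) * hζ.toInteger =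
        ((p * e : ℤ) : 𝓞 K) + ((p * f : ℤ) : 𝓞 K) * hζ.toInteger := by
      rw [hz]; push_cast; ring
    obtain ⟨h2, h3⟩ := int_coords_unique hζ h1
    have hz2 : (a : ZMod p) * c - b * d = 0 := by
      have := congrArg (Int.cast : ℤ → ZMod p) h2
      push_cast at this
      rw [this, ZMod.natCast_self, zero_mul]
    have hz3 : (a : ZMod p) * d + b * c - b * d = 0 := by
      have := congrArg (Int.cast : ℤ → ZMod p) h3
      push_cast at this
      rw [this, ZMod.natCast_self, zero_mul]
    have hprod : ((a : ZMod p) ^ 2 - a * b + b ^ 2) * ((c : ZMod p) ^ 2 - c * d + d ^ 2) = 0 := by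
      rw [← norm_form_mul, hz2, hz3]; ring
    have hdvd : ∀ {u v : ℤ}, (u : ZMod p) = 0 → (v : ZMod p) = 0 →
        ((p : ℤ) : 𝓞 K) ∣ (u : 𝓞 K) + v * hζ.toInteger := by
      intro u v hu hv
      obtain ⟨u', rfl⟩ := (ZMod.intCast_zmod_eq_zero_iff_dvd u p).mp hu
      obtain ⟨v', rfl⟩ := (ZMod.intCast_zmod_eq_zero_iff_dvd v p).mp hv
      exact ⟨(u' : 𝓞 K) + v' * hζ.toInteger, by push_cast; ring⟩
    rcases mul_eq_zero.mp hprod with h0 | h0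
    · obtain ⟨ha, hb⟩ := h _ _ h0
      exact Or.inl (hdvd ha hb)
    · obtain ⟨hc, hd⟩ := h _ _ h0
      exact Or.inr (hdvd hc hd)

/-- `2` is inert in `ℤ[ζ₃]`: `(2 : 𝓞 K)` is prime. [folklore] -/
theorem prime_two (hζ : IsPrimitiveRoot ζ 3) : Prime ((2 : ℤ) : 𝓞 K) :=
  prime_intCast_of_anisotropic hζ Nat.prime_two (by decide)

/-- **The ramified prime** `θ₀ = 2η + 1 = -η(η - 1)`, associated to `λ = η - 1`, is prime.
[folklore] (Mathlib: `IsPrimitiveRoot.zeta_sub_one_prime'`) -/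
theorem prime_two_mul_toInteger_add_one : Prime (2 * hζ.toInteger + 1 : 𝓞 K) := by
  have hl := hζ.zeta_sub_one_prime'
  have hu : IsUnit (-hζ.toInteger) := (hζ.toInteger_isPrimitiveRoot.isUnit (by norm_num)).neg
  obtain ⟨u, hu'⟩ := hu
  have heq : (hζ.toInteger - 1) * (-hζ.toInteger) = 2 * hζ.toInteger + 1 := by
    linear_combination (-1 : 𝓞 K) * toInteger_sq hζ
  have hassoc : Associated (hζ.toInteger - 1) (2 * hζ.toInteger + 1) := ⟨u, by rw [hu', heq]⟩
  exact hassoc.prime hl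

omit [NumberField K] [IsCyclotomicExtension {3} ℚ K] in
/-- `θ₀ = 2η + 1` has `(θ₀ : K) = 2ζ + 1` (matching `exists_ringOfIntegers_descent_value`). [folklore] -/
theorem coe_two_mul_toInteger_add_one :
    ((2 * hζ.toInteger + 1 : 𝓞 K) : K) = 2 * ζ + 1 := by
  change algebraMap (𝓞 K) K (2 * hζ.toInteger + 1) = _
  rw [map_add, map_mul, map_ofNat, map_one]
  rfl

omit [IsCyclotomicExtension {3} ℚ K] in
/-- **Conjugation in coordinates**: `σ(a + bη) = (a - b) - bη` for `σ ζ = ζ²`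
(input `hcσ` of `exists_normCut_class`). [folklore] -/
theorem conj_coords (σ : K ≃ₐ[ℚ] K) (hσ : σ ζ = ζ ^ 2) (a b : ℤ) :
    RingOfIntegers.mapRingEquiv (σ : K ≃+* K) ((a : 𝓞 K) + b * hζ.toInteger) =
      ((a - b : ℤ) : 𝓞 K) - b * hζ.toInteger := by
  apply RingOfIntegers.coe_injective
  change σ (algebraMap (𝓞 K) K ((a : 𝓞 K) + b * hζ.toInteger)) =
    algebraMap (𝓞 K) K (((a - b : ℤ) : 𝓞 K) - b * hζ.toInteger)
  rw [map_add, map_mul, map_intCast, map_intCast, map_sub, map_mul, map_intCast, map_intCast]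
  change σ ((a : K) + b * ζ) = ((a - b : ℤ) : K) - b * ζ
  rw [map_add, map_mul, map_intCast, map_intCast, hσ]
  have h := zeta_sq_add_zeta_add_one hζ
  push_cast
  linear_combination (b : K) * h

end Summit.BirchSwinnertonDyer.BirchSwinnertonDyer.Rank2Observatory.ThreeIso
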